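/-
Copyright (c) 2026 The decomp-a2c cell. All rights reserved.
Released under Apache 2.0 license as described in the file LICENSE.
-/
import Summits.AtomisticToContinuum.Crystallization.Theorems.ChartedZeroExcessLayeredLatticeLiouvilleWC

/-!
# ChartedZeroExcessLayeredLatticeLiouville — part WD «DivergenceMajorant»: lattice paths and the pointwise majorant of the column-flux divergence
  (decomp-a2c-lens-2, g58; helper of stmt-AtomisticToContinuum-26636, leaf (LD′) `ModalLipschitzZ`; brick (4a) `ModalLipschitzAt`, vertical half (4a⊥),
  steps (F)/(SG) of memo NODE-g58c)

WC expressed the divergence `colFlux T ψ γ m − colFlux T ψ γ (m−1)` of the column flux of a field harmonic at `X = (γ, m)` through truncated bonds from `X`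
applied to PARALLELOGRAM differences `pgram ψ X Y = (ψ Y.1 Y.2 − ψ γ Y.2) − (ψ Y.1 m − ψ γ m)` and in-plane SECOND differences
`sdiff2 ψ X Y = ψ Y.1 m + ψ (2γ − Y.1) m − 2 ψ γ m`.  This part bounds them by second-order lattice quantities:
* kernel weights: `‖nearK X Y u‖ ≤ F·idxWt (Y − X)·‖u‖` with `idxWt v = N(v)⁻⁸`, and the second-moment sum `Σ_Y idxWt (Y−X)·N(Y−X)² ≤ 54` (UV);
* TELESCOPING along a lattice line (`norm_sub_le_sum_line`) and along the two-segment lattice path from `γ` to `γ + d` (`norm_sub_le_sum_path`): a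
  difference over the in-plane displacement `d` is at most the sum of the `|d 0| + |d 1|` nearest-neighbour differences along the path;
* the parallelogram difference telescopes vertically into differences over `d` of the vertical increments, hence into `h·(|d 0| + |d 1|)` MIXED second
  differences `D₁D₃ψ`, `D₂D₃ψ` along the path (`norm_pgram_le`);
* the second difference is a difference over `d` of a difference over `d`: at most `(|d 0| + |d 1|)²·G₂` when the in-plane second differences are bounded by
  `G₂` on the doubled bounding box (`norm_sdiff2_le`);
* ★ `norm_colFluxDiv_le`: `‖colFlux(m) − colFlux(m−1)‖ ≤ F·Σ_{Y near X} idxWt (Y−X)·(‖pgram ψ X Y‖ + ‖sdiff2 ψ X Y‖)`.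
-/

namespace Summit.AtomisticToContinuum.Crystallization.Theorems.ChartedZeroExcessLayeredLatticeLiouville

open Summit.AtomisticToContinuum.Crystallization.Theorems.ChartedPlanarOrderRigidityDoor (E3)
open Finset
open scoped InnerProductSpace RealInnerProductSpace BigOperators

noncomputable section DivergenceMajorant

variable {c : ℝ} {a b : E3} {w : ℤ → E3}

/-! ### WD.1  Kernel weights and their second moment -/

/-- the INDEX WEIGHT `N(v)⁻⁸` of an offset `v` (the decay of the linearised kernel, UY `norm_layeredKernel_le`; `0` on the diagonal). [this file, g58] -/
def idxWt (v : Cell 2 × ℤ) : ℝ := (((idxNorm v : ℝ))⁻¹) ^ 8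

/-- index weights are non-negative. [formal bookkeeping] -/
theorem idxWt_nonneg (v : Cell 2 × ℤ) : 0 ≤ idxWt v := by
  unfold idxWt; positivity

/-- every truncated bond is bounded by `F(c)·N(Y − X)⁻⁸`. [formal bookkeeping] -/
theorem norm_nearK_le_idxWt (hc : 0 < c) (hL : IsLayeredCrystal c a b w) (ϱ : ℝ) (X Y : Cell 2 × ℤ) (u : E3) :
    ‖nearK ϱ a b w X Y u‖ ≤ kernelConst c * idxWt (Y - X) * ‖u‖ :=
  (norm_nearK_le ϱ a b w X Y u).trans (mul_le_mul_of_nonneg_right (norm_layeredKernel_le hc hL X Y) (norm_nonneg u))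

/-- the second moment of one weight is dominated by UV's shell weight `N⁻⁷·N²`. [formal bookkeeping] -/
theorem idxWt_mul_sq_le (v : Cell 2 × ℤ) : idxWt v * (idxNorm v : ℝ) ^ 2 ≤ (((idxNorm v : ℝ)) ^ 7)⁻¹ * (idxNorm v : ℝ) ^ 2 := by
  rcases Nat.eq_zero_or_pos (idxNorm v) with h0 | hpos
  · simp [idxWt, h0]
  · have hN1 : (1 : ℝ) ≤ (idxNorm v : ℝ) := by exact_mod_cast hpos
    refine mul_le_mul_of_nonneg_right ?_ (by positivity)
    unfold idxWt
    calc (((idxNorm v : ℝ))⁻¹) ^ 8 ≤ (((idxNorm v : ℝ))⁻¹) ^ 7 :=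
          pow_le_pow_of_le_one (by positivity) (inv_le_one_of_one_le₀ hN1) (by norm_num)
      _ = (((idxNorm v : ℝ)) ^ 7)⁻¹ := by rw [inv_pow]

/-- ★ THE SECOND MOMENT of the index weights about any centre is at most `54` (UY `sum_idxWeight_shift_le`). [this file, g58] -/
theorem sum_idxWt_mul_sq_le (V : Finset (Cell 2 × ℤ)) (X : Cell 2 × ℤ) :
    ∑ Y ∈ V, idxWt (Y - X) * (idxNorm (Y - X) : ℝ) ^ 2 ≤ 54 :=
  (sum_le_sum fun Y _ => idxWt_mul_sq_le (Y - X)).trans (sum_idxWeight_shift_le V X)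

/-! ### WD.2  Telescoping along lattice lines and two-segment lattice paths -/

/-- TELESCOPING ALONG A LATTICE LINE: `‖g t − g 0‖` is at most the sum of the `|t|` nearest-neighbour differences of `g` on the segment between `0` and `t`.
[formal bookkeeping] -/
theorem norm_sub_le_sum_line (g : ℤ → E3) (t : ℤ) :
    ‖g t - g 0‖ ≤ ∑ i ∈ range t.natAbs, ‖g (min t 0 + ((i + 1 : ℕ) : ℤ)) - g (min t 0 + ((i : ℕ) : ℤ))‖ := by
  have hsum : ∑ i ∈ range t.natAbs, (g (min t 0 + ((i + 1 : ℕ) : ℤ)) - g (min t 0 + ((i : ℕ) : ℤ))) =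
      g (min t 0 + ((t.natAbs : ℕ) : ℤ)) - g (min t 0 + ((0 : ℕ) : ℤ)) :=
    Finset.sum_range_sub (fun i : ℕ => g (min t 0 + ((i : ℕ) : ℤ))) t.natAbs
  rcases le_or_gt 0 t with ht | ht
  · rw [min_eq_right ht] at hsum ⊢
    have h1 : g t - g 0 = ∑ i ∈ range t.natAbs, (g (0 + ((i + 1 : ℕ) : ℤ)) - g (0 + ((i : ℕ) : ℤ))) := by
      rw [hsum]
      simp only [Nat.cast_zero, add_zero, zero_add, Int.natAbs_of_nonneg ht]
    rw [h1]
    exact norm_sum_le _ _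
  · rw [min_eq_left ht.le] at hsum ⊢
    have ht' : t + ((t.natAbs : ℕ) : ℤ) = 0 := by omega
    have h1 : g 0 - g t = ∑ i ∈ range t.natAbs, (g (t + ((i + 1 : ℕ) : ℤ)) - g (t + ((i : ℕ) : ℤ))) := by
      rw [hsum]
      simp only [Nat.cast_zero, add_zero, ht']
    rw [← norm_neg, neg_sub, h1]
    exact norm_sum_le _ _

/-- an in-plane displacement is the sum of its two axis components. [formal bookkeeping] -/
theorem cell_decomp (d : Cell 2) : d = d 0 • (Pi.single 0 1 : Cell 2) + d 1 • (Pi.single 1 1 : Cell 2) := by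
  funext j
  fin_cases j <;> simp

/-- TELESCOPING ALONG THE TWO-SEGMENT LATTICE PATH from `γ` to `γ + d` (first `|d 0|` steps along the first axis, then `|d 1|` steps along the second):
a difference over the in-plane displacement `d` is at most the sum of the nearest-neighbour differences along the path. [this file, g58] -/
theorem norm_sub_le_sum_path (f : Cell 2 → E3) (γ d : Cell 2) :
    ‖f (γ + d) - f γ‖ ≤
      (∑ i ∈ range (d 0).natAbs, ‖f (γ + (min (d 0) 0 + ((i + 1 : ℕ) : ℤ)) • (Pi.single 0 1 : Cell 2)) -
          f (γ + (min (d 0) 0 + ((i : ℕ) : ℤ)) • (Pi.single 0 1 : Cell 2))‖) +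
        ∑ i ∈ range (d 1).natAbs, ‖f (γ + d 0 • (Pi.single 0 1 : Cell 2) + (min (d 1) 0 + ((i + 1 : ℕ) : ℤ)) • (Pi.single 1 1 : Cell 2)) -
          f (γ + d 0 • (Pi.single 0 1 : Cell 2) + (min (d 1) 0 + ((i : ℕ) : ℤ)) • (Pi.single 1 1 : Cell 2))‖ := by
  have hd : γ + d = γ + d 0 • (Pi.single 0 1 : Cell 2) + d 1 • (Pi.single 1 1 : Cell 2) := by
    rw [add_assoc, ← cell_decomp d]
  have h1 := norm_sub_le_sum_line (fun t : ℤ => f (γ + t • (Pi.single 0 1 : Cell 2))) (d 0)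
  have h2 := norm_sub_le_sum_line (fun t : ℤ => f (γ + d 0 • (Pi.single 0 1 : Cell 2) + t • (Pi.single 1 1 : Cell 2))) (d 1)
  simp only [zero_smul, add_zero] at h1 h2
  have hsplit : f (γ + d) - f γ = (f (γ + d 0 • (Pi.single 0 1 : Cell 2)) - f γ) +
      (f (γ + d 0 • (Pi.single 0 1 : Cell 2) + d 1 • (Pi.single 1 1 : Cell 2)) - f (γ + d 0 • (Pi.single 0 1 : Cell 2))) := by
    rw [hd]; abel
  rw [hsplit]
  exact (norm_add_le _ _).trans (add_le_add h1 h2)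

/-- SUP FORM of the path bound: if the nearest-neighbour differences along the path are bounded by `G`, the difference over `d` is at most
`(|d 0| + |d 1|)·G`. [formal bookkeeping] -/
theorem norm_sub_le_card_mul (f : Cell 2 → E3) (γ d : Cell 2) {G : ℝ}
    (h₁ : ∀ i ∈ range (d 0).natAbs, ‖f (γ + (min (d 0) 0 + ((i + 1 : ℕ) : ℤ)) • (Pi.single 0 1 : Cell 2)) -
      f (γ + (min (d 0) 0 + ((i : ℕ) : ℤ)) • (Pi.single 0 1 : Cell 2))‖ ≤ G)
    (h₂ : ∀ i ∈ range (d 1).natAbs, ‖f (γ + d 0 • (Pi.single 0 1 : Cell 2) + (min (d 1) 0 + ((i + 1 : ℕ) : ℤ)) • (Pi.single 1 1 : Cell 2)) -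
      f (γ + d 0 • (Pi.single 0 1 : Cell 2) + (min (d 1) 0 + ((i : ℕ) : ℤ)) • (Pi.single 1 1 : Cell 2))‖ ≤ G) :
    ‖f (γ + d) - f γ‖ ≤ ((((d 0).natAbs + (d 1).natAbs : ℕ)) : ℝ) * G := by
  refine (norm_sub_le_sum_path f γ d).trans ?_
  have e1 := sum_le_card_nsmul _ _ G h₁
  have e2 := sum_le_card_nsmul _ _ G h₂
  rw [card_range, nsmul_eq_mul] at e1 e2
  rw [Nat.cast_add, add_mul]
  exact add_le_add e1 e2

/-! ### WD.3  Axis steps -/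

/-- the path step `(b + (i+1))•s = (b + i)•s + s`. [formal bookkeeping] -/
theorem step_smul (b : ℤ) (i : ℕ) (s : Cell 2) : (b + ((i + 1 : ℕ) : ℤ)) • s = (b + ((i : ℕ) : ℤ)) • s + s := by
  rw [Nat.cast_succ, ← add_assoc, add_smul, one_smul]

/-- the first in-plane difference field, evaluated. [formal bookkeeping] -/
theorem latDiff_axis₁_apply (φ : Cell 2 → ℤ → E3) (p : Cell 2) (α : ℤ) :
    latDiff idxAxis₁ φ p α = φ (p + (Pi.single 0 1 : Cell 2)) α - φ p α := by
  simp [latDiff, latShift, idxAxis₁]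

/-- the second in-plane difference field, evaluated. [formal bookkeeping] -/
theorem latDiff_axis₂_apply (φ : Cell 2 → ℤ → E3) (p : Cell 2) (α : ℤ) :
    latDiff idxAxis₂ φ p α = φ (p + (Pi.single 1 1 : Cell 2)) α - φ p α := by
  simp [latDiff, latShift, idxAxis₂]

/-- the vertical difference field, evaluated. [formal bookkeeping] -/
theorem latDiff_axis₃_apply (φ : Cell 2 → ℤ → E3) (p : Cell 2) (α : ℤ) :
    latDiff idxAxis₃ φ p α = φ p (α + 1) - φ p α := by
  simp [latDiff, latShift, idxAxis₃]

/-! ### WD.4  The parallelogram difference -/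

/-- the PARALLELOGRAM (mixed vertical / in-plane second) difference of `ψ` on the sites `X`, `Y`, `(X.1, Y.2)`, `(Y.1, X.2)`:
`(ψ Y.1 Y.2 − ψ X.1 Y.2) − (ψ Y.1 X.2 − ψ X)` (vanishes when `Y` lies in the layer or in the column of `X`). [this file, g58] -/
def pgram (ψ : Cell 2 → ℤ → E3) (X Y : Cell 2 × ℤ) : E3 :=
  (ψ Y.1 Y.2 - ψ X.1 Y.2) - (ψ Y.1 X.2 - ψ X.1 X.2)

/-- VERTICAL TELESCOPING of the parallelogram difference: for `Y` lying `h` layers BELOW the layer of `X` it is the sum over the `h` gaps in between of the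
differences over the in-plane displacement `Y.1 − X.1` of the vertical increments. [formal bookkeeping] -/
theorem pgram_eq_sum (ψ : Cell 2 → ℤ → E3) (γ d : Cell 2) (β : ℤ) (h : ℕ) :
    pgram ψ (γ, β + h) (γ + d, β) =
      -∑ j ∈ range h, (latDiff idxAxis₃ ψ (γ + d) (β + ((j : ℕ) : ℤ)) - latDiff idxAxis₃ ψ γ (β + ((j : ℕ) : ℤ))) := by
  have e1 := Finset.sum_range_sub (fun j : ℕ => ψ (γ + d) (β + ((j : ℕ) : ℤ))) h
  have e2 := Finset.sum_range_sub (fun j : ℕ => ψ γ (β + ((j : ℕ) : ℤ))) h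
  simp only [Nat.cast_zero, add_zero] at e1 e2
  simp only [pgram, latDiff_axis₃_apply]
  have e1' : ∑ j ∈ range h, (ψ (γ + d) (β + ((j : ℕ) : ℤ) + 1) - ψ (γ + d) (β + ((j : ℕ) : ℤ))) = ψ (γ + d) (β + (h : ℕ)) - ψ (γ + d) β := by
    rw [← e1]
    refine sum_congr rfl fun j _ => ?_
    rw [Nat.cast_succ, add_assoc]
  have e2' : ∑ j ∈ range h, (ψ γ (β + ((j : ℕ) : ℤ) + 1) - ψ γ (β + ((j : ℕ) : ℤ))) = ψ γ (β + (h : ℕ)) - ψ γ β := by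
    rw [← e2]
    refine sum_congr rfl fun j _ => ?_
    rw [Nat.cast_succ, add_assoc]
  rw [sum_sub_distrib, e1', e2']
  abel

/-- ★ THE PARALLELOGRAM BOUND: for `Y = (γ + d, β)` lying `h` layers below `X = (γ, β + h)`, `‖pgram ψ X Y‖` is at most the sum over the `h` gaps
`j ∈ [β, β + h)` and over the two-segment lattice path from `γ` to `γ + d` of the norms of the MIXED second differences `D₁D₃ψ`, `D₂D₃ψ`
(`pgram_eq_sum` + `norm_sub_le_sum_path` gap by gap). [this file, g58] -/
theorem norm_pgram_le (ψ : Cell 2 → ℤ → E3) (γ d : Cell 2) (β : ℤ) (h : ℕ) :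
    ‖pgram ψ (γ, β + h) (γ + d, β)‖ ≤
      ∑ j ∈ range h,
        ((∑ i ∈ range (d 0).natAbs,
            ‖latDiff idxAxis₁ (latDiff idxAxis₃ ψ) (γ + (min (d 0) 0 + ((i : ℕ) : ℤ)) • (Pi.single 0 1 : Cell 2)) (β + ((j : ℕ) : ℤ))‖) +
          ∑ i ∈ range (d 1).natAbs,
            ‖latDiff idxAxis₂ (latDiff idxAxis₃ ψ) (γ + d 0 • (Pi.single 0 1 : Cell 2) + (min (d 1) 0 + ((i : ℕ) : ℤ)) • (Pi.single 1 1 : Cell 2))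
              (β + ((j : ℕ) : ℤ))‖) := by
  rw [pgram_eq_sum, norm_neg]
  refine (norm_sum_le _ _).trans (sum_le_sum fun j _ => ?_)
  refine (norm_sub_le_sum_path (fun δ : Cell 2 => latDiff idxAxis₃ ψ δ (β + ((j : ℕ) : ℤ))) γ d).trans (le_of_eq ?_)
  simp only [latDiff_axis₁_apply, latDiff_axis₂_apply, step_smul, add_assoc]

/-! ### WD.5  The in-plane second difference -/

/-- the in-plane SECOND difference of the layer of `X` over the displacement `Y.1 − X.1` and its point reflection:
`ψ Y.1 X.2 + ψ (2 X.1 − Y.1) X.2 − 2 ψ X`. [this file, g58] -/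
def sdiff2 (ψ : Cell 2 → ℤ → E3) (X Y : Cell 2 × ℤ) : E3 :=
  ψ Y.1 X.2 + ψ (X.1 + X.1 - Y.1) X.2 - (ψ X.1 X.2 + ψ X.1 X.2)

/-- coordinates of the first axis step. [formal bookkeeping] -/
theorem axisStep₀_apply_zero : (Pi.single 0 1 : Cell 2) 0 = 1 := by simp

/-- coordinates of the first axis step. [formal bookkeeping] -/
theorem axisStep₀_apply_one : (Pi.single 0 1 : Cell 2) 1 = 0 := by simp

/-- coordinates of the second axis step. [formal bookkeeping] -/
theorem axisStep₁_apply_zero : (Pi.single 1 1 : Cell 2) 0 = 0 := by simp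

/-- coordinates of the second axis step. [formal bookkeeping] -/
theorem axisStep₁_apply_one : (Pi.single 1 1 : Cell 2) 1 = 1 := by simp

/-- the path points of the two-segment path stay in the coordinate box of its endpoints (first segment). [formal bookkeeping] -/
theorem path_pt₁_sub (γ d : Cell 2) {i : ℕ} (hi : i ∈ range (d 0).natAbs) :
    ∀ j : Fin 2, |(γ + (min (d 0) 0 + ((i : ℕ) : ℤ)) • (Pi.single 0 1 : Cell 2)) j - γ j| ≤ |d j| := by
  rw [mem_range] at hi
  refine Fin.forall_fin_two.mpr ⟨?_, ?_⟩
  · simp only [Pi.add_apply, Pi.smul_apply, smul_eq_mul, axisStep₀_apply_zero, mul_one, add_sub_cancel_left]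
    rw [Int.abs_eq_natAbs, Int.abs_eq_natAbs]
    omega
  · simp only [Pi.add_apply, Pi.smul_apply, smul_eq_mul, axisStep₀_apply_one, mul_zero, add_zero, sub_self, abs_zero]
    exact abs_nonneg _

/-- the path points of the two-segment path stay in the coordinate box of its endpoints (second segment). [formal bookkeeping] -/
theorem path_pt₂_sub (γ d : Cell 2) {i : ℕ} (hi : i ∈ range (d 1).natAbs) :
    ∀ j : Fin 2, |(γ + d 0 • (Pi.single 0 1 : Cell 2) + (min (d 1) 0 + ((i : ℕ) : ℤ)) • (Pi.single 1 1 : Cell 2)) j - γ j| ≤ |d j| := by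
  rw [mem_range] at hi
  refine Fin.forall_fin_two.mpr ⟨?_, ?_⟩
  · simp only [Pi.add_apply, Pi.smul_apply, smul_eq_mul, axisStep₀_apply_zero, axisStep₁_apply_zero, mul_one, mul_zero, add_zero,
      add_sub_cancel_left, le_refl]
  · simp only [Pi.add_apply, Pi.smul_apply, smul_eq_mul, axisStep₀_apply_one, axisStep₁_apply_one, mul_one, mul_zero, add_zero,
      add_sub_cancel_left]
    rw [Int.abs_eq_natAbs, Int.abs_eq_natAbs]
    omega

/-- SUP BOUND for a difference over `d` from bounds on the unit differences in the coordinate box `{p | ∀ j, |p j − γ j| ≤ M}`, `|d j| ≤ M`.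
[formal bookkeeping] -/
theorem norm_sub_le_of_box (f : Cell 2 → E3) (γ d : Cell 2) {M : ℤ} (hM : ∀ j, |d j| ≤ M) {G : ℝ}
    (hG : ∀ p : Cell 2, (∀ j, |p j - γ j| ≤ M) →
      ‖f (p + (Pi.single 0 1 : Cell 2)) - f p‖ ≤ G ∧ ‖f (p + (Pi.single 1 1 : Cell 2)) - f p‖ ≤ G) :
    ‖f (γ + d) - f γ‖ ≤ ((((d 0).natAbs + (d 1).natAbs : ℕ)) : ℝ) * G := by
  refine norm_sub_le_card_mul f γ d (fun i hi => ?_) (fun i hi => ?_)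
  · rw [step_smul, ← add_assoc]
    exact (hG _ fun j => (path_pt₁_sub γ d hi j).trans (hM j)).1
  · rw [step_smul, ← add_assoc]
    exact (hG _ fun j => (path_pt₂_sub γ d hi j).trans (hM j)).2

/-- ★ THE SECOND-DIFFERENCE BOUND: if the four in-plane second differences `D_{E'}D_E ψ` (`E, E'` the two axis steps) of the layer `m` are bounded by `G₂`
on the coordinate box of half-width `3M` about `γ` (`|d j| ≤ M`), then `‖sdiff2 ψ (γ, m) (γ + d, β)‖ ≤ (|d 0| + |d 1|)²·G₂`: the second difference is the
difference over `d` (based at `γ − d`) of the difference field `δ ↦ ψ (δ + d) m − ψ δ m`, whose unit differences are differences over `d` of `D_E ψ`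
(`norm_sub_le_of_box` twice). [this file, g58] -/
theorem norm_sdiff2_le (ψ : Cell 2 → ℤ → E3) (γ d : Cell 2) (m β : ℤ) {M : ℤ} (hM : ∀ j, |d j| ≤ M) {G₂ : ℝ}
    (hG : ∀ p : Cell 2, (∀ j, |p j - γ j| ≤ M + M + M) →
      ‖latDiff idxAxis₁ (latDiff idxAxis₁ ψ) p m‖ ≤ G₂ ∧ ‖latDiff idxAxis₂ (latDiff idxAxis₁ ψ) p m‖ ≤ G₂ ∧
      ‖latDiff idxAxis₁ (latDiff idxAxis₂ ψ) p m‖ ≤ G₂ ∧ ‖latDiff idxAxis₂ (latDiff idxAxis₂ ψ) p m‖ ≤ G₂) :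
    ‖sdiff2 ψ (γ, m) (γ + d, β)‖ ≤ ((((d 0).natAbs + (d 1).natAbs : ℕ)) : ℝ) ^ 2 * G₂ := by
  have hM0 : ∀ j, 0 ≤ M := fun j => (abs_nonneg _).trans (hM j)
  -- the second difference as a difference over `d` of `W δ := ψ (δ + d) m − ψ δ m`, based at `γ − d`
  have hS : sdiff2 ψ (γ, m) (γ + d, β) = (ψ (γ - d + d + d) m - ψ (γ - d + d) m) - (ψ (γ - d + d) m - ψ (γ - d) m) := by
    simp only [sdiff2, sub_add_cancel]
    rw [show γ + γ - (γ + d) = γ - d by abel]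
    abel
  rw [hS, sq, mul_assoc]
  refine norm_sub_le_of_box (fun δ : Cell 2 => ψ (δ + d) m - ψ δ m) (γ - d) d hM fun p hp => ⟨?_, ?_⟩
  · -- unit difference of `W` along the first axis = difference over `d` of `D₁ψ`, based at `p`
    have hp' : ∀ q : Cell 2, (∀ j, |q j - p j| ≤ M) → ∀ j, |q j - γ j| ≤ M + M + M := by
      intro q hq j
      have h1 := hq j
      have h2 := hp j
      have h3 := hM j
      simp only [Pi.sub_apply] at h2
      rw [abs_le] at h1 h2 h3 ⊢
      constructor <;> linarith [h1.1, h1.2, h2.1, h2.2, h3.1, h3.2]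
    have key := norm_sub_le_of_box (fun δ : Cell 2 => latDiff idxAxis₁ ψ δ m) p d hM fun q hq =>
      ⟨by rw [← latDiff_axis₁_apply (latDiff idxAxis₁ ψ)]; exact (hG q (hp' q hq)).1,
       by rw [← latDiff_axis₂_apply (latDiff idxAxis₁ ψ)]; exact (hG q (hp' q hq)).2.1⟩
    simp only [latDiff_axis₁_apply] at key
    rw [show ψ (p + (Pi.single 0 1 : Cell 2) + d) m - ψ (p + (Pi.single 0 1 : Cell 2)) m - (ψ (p + d) m - ψ p m) =
      ψ (p + d + (Pi.single 0 1 : Cell 2)) m - ψ (p + d) m - (ψ (p + (Pi.single 0 1 : Cell 2)) m - ψ p m) by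
        rw [add_right_comm]; abel]
    exact key
  · have hp' : ∀ q : Cell 2, (∀ j, |q j - p j| ≤ M) → ∀ j, |q j - γ j| ≤ M + M + M := by
      intro q hq j
      have h1 := hq j
      have h2 := hp j
      have h3 := hM j
      simp only [Pi.sub_apply] at h2
      rw [abs_le] at h1 h2 h3 ⊢
      constructor <;> linarith [h1.1, h1.2, h2.1, h2.2, h3.1, h3.2]
    have key := norm_sub_le_of_box (fun δ : Cell 2 => latDiff idxAxis₂ ψ δ m) p d hM fun q hq =>
      ⟨by rw [← latDiff_axis₁_apply (latDiff idxAxis₂ ψ)]; exact (hG q (hp' q hq)).2.2.1,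
       by rw [← latDiff_axis₂_apply (latDiff idxAxis₂ ψ)]; exact (hG q (hp' q hq)).2.2.2⟩
    simp only [latDiff_axis₂_apply] at key
    rw [show ψ (p + (Pi.single 1 1 : Cell 2) + d) m - ψ (p + (Pi.single 1 1 : Cell 2)) m - (ψ (p + d) m - ψ p m) =
      ψ (p + d + (Pi.single 1 1 : Cell 2)) m - ψ (p + d) m - (ψ (p + (Pi.single 1 1 : Cell 2)) m - ψ p m) by
        rw [add_right_comm]; abel]
    exact key

/-! ### WD.6  ★ The pointwise majorant of the divergence -/

/-- ★★ THE POINTWISE MAJORANT OF THE DIVERGENCE of the column flux of a field harmonic at `X = (γ, m)`: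
`‖colFlux T ψ γ m − colFlux T ψ γ (m−1)‖ ≤ 2·F·Σ_{Y near X} idxWt (Y − X)·(‖pgram ψ X Y‖ + ‖sdiff2 ψ X Y‖)`
(WC `colFlux_sub_colFlux_of_residual`, the pair terms `siteFlux_add_siteFlux_eq_sum` and the symmetrised self term `two_smul_siteFlux_self_eq_sum`,
bond by bond `norm_nearK_le_idxWt`; the pair fibres `β < m` and the self fibre `β = m` are both dominated by the full sum over the near sites).
[this file, g58] -/
theorem norm_colFluxDiv_le (hc : 0 < c) (hL : IsLayeredCrystal c a b w) {ϱ : ℝ} (ψ : Cell 2 → ℤ → E3) {T : Finset ℤ} {γ : Cell 2} {m : ℤ}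
    (hm : m ∈ T) (hS : ∀ Y : Cell 2 × ℤ, ‖lsite a b w Y.1 Y.2 - lsite a b w γ m‖ ≤ ϱ → Y.2 ∈ T) (hres : truncResidual ϱ a b w ψ (γ, m) = 0) :
    ‖colFlux ϱ a b w T ψ γ m - colFlux ϱ a b w T ψ γ (m - 1)‖ ≤
      2 * kernelConst c * ∑ Y ∈ (finite_near_lsite hc hL (γ, m) ϱ).toFinset, idxWt (Y - (γ, m)) * (‖pgram ψ (γ, m) Y‖ + ‖sdiff2 ψ (γ, m) Y‖) := by
  have hN : ∀ Y : Cell 2 × ℤ, ‖lsite a b w Y.1 Y.2 - lsite a b w γ m‖ ≤ ϱ → Y ∈ (finite_near_lsite hc hL (γ, m) ϱ).toFinset :=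
    mem_nearFinset_of_le hc hL ϱ (γ, m)
  have hF := kernelConst_nonneg hc
  have hG0 : ∀ Y : Cell 2 × ℤ, 0 ≤ idxWt (Y - (γ, m)) * (‖pgram ψ (γ, m) Y‖ + ‖sdiff2 ψ (γ, m) Y‖) :=
    fun Y => mul_nonneg (idxWt_nonneg _) (add_nonneg (norm_nonneg _) (norm_nonneg _))
  -- the pair terms
  have hpair : ∀ β ∈ T.filter (· < m), ‖siteFlux ϱ a b w ψ (γ, m) β + siteFlux ϱ a b w ψ (γ, β) m‖ ≤
      kernelConst c * ∑ Y ∈ (finite_near_lsite hc hL (γ, m) ϱ).toFinset with Y.2 = β,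
        idxWt (Y - (γ, m)) * (‖pgram ψ (γ, m) Y‖ + ‖sdiff2 ψ (γ, m) Y‖) := by
    intro β _
    rw [siteFlux_add_siteFlux_eq_sum hN ψ β, mul_sum]
    refine (norm_sum_le _ _).trans (sum_le_sum fun Y hY => ?_)
    have hY2 : Y.2 = β := (mem_filter.mp hY).2
    refine (norm_nearK_le_idxWt hc hL ϱ (γ, m) Y _).trans ?_
    rw [mul_assoc]
    refine mul_le_mul_of_nonneg_left (mul_le_mul_of_nonneg_left ?_ (idxWt_nonneg _)) hF
    rw [← hY2]
    exact norm_add_le _ _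
  -- the self term
  have hself : ‖siteFlux ϱ a b w ψ (γ, m) m‖ ≤
      kernelConst c * ∑ Y ∈ (finite_near_lsite hc hL (γ, m) ϱ).toFinset with Y.2 = m,
        idxWt (Y - (γ, m)) * (‖pgram ψ (γ, m) Y‖ + ‖sdiff2 ψ (γ, m) Y‖) := by
    have h2 : ‖(2 : ℝ) • siteFlux ϱ a b w ψ (γ, m) m‖ ≤
        kernelConst c * ∑ Y ∈ (finite_near_lsite hc hL (γ, m) ϱ).toFinset with Y.2 = m,
          idxWt (Y - (γ, m)) * (‖pgram ψ (γ, m) Y‖ + ‖sdiff2 ψ (γ, m) Y‖) := by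
      rw [two_smul_siteFlux_self_eq_sum hN ψ, mul_sum]
      refine (norm_sum_le _ _).trans (sum_le_sum fun Y _ => ?_)
      refine (norm_nearK_le_idxWt hc hL ϱ (γ, m) Y _).trans ?_
      rw [mul_assoc]
      refine mul_le_mul_of_nonneg_left (mul_le_mul_of_nonneg_left ?_ (idxWt_nonneg _)) hF
      exact le_add_of_nonneg_left (norm_nonneg _)
    rw [norm_smul, Real.norm_two] at h2
    have hsum0 : 0 ≤ kernelConst c * ∑ Y ∈ (finite_near_lsite hc hL (γ, m) ϱ).toFinset with Y.2 = m,
        idxWt (Y - (γ, m)) * (‖pgram ψ (γ, m) Y‖ + ‖sdiff2 ψ (γ, m) Y‖) := mul_nonneg hF (sum_nonneg fun Y _ => hG0 Y)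
    linarith [norm_nonneg (siteFlux ϱ a b w ψ (γ, m) m)]
  -- assembling: both fibre sums are dominated by the full sum over the near sites
  have hfib : ∑ β ∈ T with β < m, ∑ Y ∈ (finite_near_lsite hc hL (γ, m) ϱ).toFinset with Y.2 = β,
      idxWt (Y - (γ, m)) * (‖pgram ψ (γ, m) Y‖ + ‖sdiff2 ψ (γ, m) Y‖) ≤
        ∑ Y ∈ (finite_near_lsite hc hL (γ, m) ϱ).toFinset, idxWt (Y - (γ, m)) * (‖pgram ψ (γ, m) Y‖ + ‖sdiff2 ψ (γ, m) Y‖) :=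
    sum_fiberwise_le_sum_of_sum_fiber_nonneg fun β _ => sum_nonneg fun Y _ => hG0 Y
  have hfibm : ∑ Y ∈ (finite_near_lsite hc hL (γ, m) ϱ).toFinset with Y.2 = m,
      idxWt (Y - (γ, m)) * (‖pgram ψ (γ, m) Y‖ + ‖sdiff2 ψ (γ, m) Y‖) ≤
      ∑ Y ∈ (finite_near_lsite hc hL (γ, m) ϱ).toFinset, idxWt (Y - (γ, m)) * (‖pgram ψ (γ, m) Y‖ + ‖sdiff2 ψ (γ, m) Y‖) :=
    sum_le_sum_of_subset_of_nonneg (filter_subset _ _) fun Y _ _ => hG0 Y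
  rw [colFlux_sub_colFlux_of_residual hc hL ψ hm hS hres, ← neg_add', norm_neg]
  refine (norm_add_le _ _).trans ?_
  refine (add_le_add ((norm_sum_le _ _).trans (sum_le_sum hpair)) hself).trans ?_
  rw [← mul_sum]
  have e1 := mul_le_mul_of_nonneg_left hfib hF
  have e2 := mul_le_mul_of_nonneg_left hfibm hF
  linarith

/-! ### WD.7  The closed statement of this part -/

/-- The content of part WD as one closed proposition: the second moment of the index weights, the parallelogram bound, the second-difference bound and
the pointwise majorant of the divergence of the column flux of a field harmonic at a site. -/
def DivergenceMajorantShape : Prop :=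
  (∀ (V : Finset (Cell 2 × ℤ)) (X : Cell 2 × ℤ), ∑ Y ∈ V, idxWt (Y - X) * (idxNorm (Y - X) : ℝ) ^ 2 ≤ 54) ∧
  (∀ (ψ : Cell 2 → ℤ → E3) (γ d : Cell 2) (β : ℤ) (h : ℕ),
    ‖pgram ψ (γ, β + h) (γ + d, β)‖ ≤
      ∑ j ∈ range h,
        ((∑ i ∈ range (d 0).natAbs,
            ‖latDiff idxAxis₁ (latDiff idxAxis₃ ψ) (γ + (min (d 0) 0 + ((i : ℕ) : ℤ)) • (Pi.single 0 1 : Cell 2)) (β + ((j : ℕ) : ℤ))‖) +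
          ∑ i ∈ range (d 1).natAbs,
            ‖latDiff idxAxis₂ (latDiff idxAxis₃ ψ) (γ + d 0 • (Pi.single 0 1 : Cell 2) + (min (d 1) 0 + ((i : ℕ) : ℤ)) • (Pi.single 1 1 : Cell 2))
              (β + ((j : ℕ) : ℤ))‖)) ∧
  (∀ (ψ : Cell 2 → ℤ → E3) (γ d : Cell 2) (m β M : ℤ), (∀ j, |d j| ≤ M) → ∀ G₂ : ℝ,
    (∀ p : Cell 2, (∀ j, |p j - γ j| ≤ M + M + M) →
      ‖latDiff idxAxis₁ (latDiff idxAxis₁ ψ) p m‖ ≤ G₂ ∧ ‖latDiff idxAxis₂ (latDiff idxAxis₁ ψ) p m‖ ≤ G₂ ∧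
      ‖latDiff idxAxis₁ (latDiff idxAxis₂ ψ) p m‖ ≤ G₂ ∧ ‖latDiff idxAxis₂ (latDiff idxAxis₂ ψ) p m‖ ≤ G₂) →
    ‖sdiff2 ψ (γ, m) (γ + d, β)‖ ≤ ((((d 0).natAbs + (d 1).natAbs : ℕ)) : ℝ) ^ 2 * G₂) ∧
  ∀ c : ℝ, ∀ hc : 0 < c, ∀ (a b : E3) (w : ℤ → E3) (hL : IsLayeredCrystal c a b w) (ϱ : ℝ) (ψ : Cell 2 → ℤ → E3) (T : Finset ℤ)
    (γ : Cell 2) (m : ℤ), m ∈ T → (∀ Y : Cell 2 × ℤ, ‖lsite a b w Y.1 Y.2 - lsite a b w γ m‖ ≤ ϱ → Y.2 ∈ T) →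
    truncResidual ϱ a b w ψ (γ, m) = 0 →
    ‖colFlux ϱ a b w T ψ γ m - colFlux ϱ a b w T ψ γ (m - 1)‖ ≤
      2 * kernelConst c * ∑ Y ∈ (finite_near_lsite hc hL (γ, m) ϱ).toFinset, idxWt (Y - (γ, m)) * (‖pgram ψ (γ, m) Y‖ + ‖sdiff2 ψ (γ, m) Y‖)

/-- WD holds. [this file, g58] -/
theorem divergenceMajorantShape_holds : DivergenceMajorantShape :=
  ⟨sum_idxWt_mul_sq_le, fun ψ γ d β h => norm_pgram_le ψ γ d β h, fun ψ γ d m β _M hM _G₂ hG => norm_sdiff2_le ψ γ d m β hM hG,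
    fun _c hc _a _b _w hL _ϱ ψ _T _γ _m hm hS hres => norm_colFluxDiv_le hc hL ψ hm hS hres⟩

end DivergenceMajorant

end Summit.AtomisticToContinuum.Crystallization.Theorems.ChartedZeroExcessLayeredLatticeLiouville
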